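import Mathlib
import Summits.PneNP.PneNP.Theses.PrimalityPlaces
import Literature.Computability.MetaComplexity.ResolutionPlays

/-!
# `PrimalityWidthHard` (crux `stmt-PneNP-16924`, route `PrimalityPlaces`): setup for the low-edge
# width-4 refutations (negative-side support)

Support file for `PrimalityWidthHardFalseOfLowEdgePrimesIO.lean` (same directory):

* the route file's inline `let`-encoding `balancedCNF n p` (array multiplier, output units, balance
  units) mirrored as definitions — `primalityWidthHard_iff` restates the crux through them by `Iff.rfl`;
* width-4 derivability `NarrowDerivable φ 4` (the Atserias–Dalmau closure of `ResolutionPlays.lean`)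
  with weakening folded in (`nd_ax`, `nd_res`: only SYNTACTIC membership of literals is ever needed,
  never distinctness of variable indices) and its conversion to a list refutation of width `≤ 4`;
* the backward full-adder step (`cell_inputs_false`: sum `0` and carry-out `0` force the three inputs
  to `0` in width 4; `corner_inputs_false`), clause membership in `balancedCNF n p`, and the index
  identities of the accumulator wiring.
-/

-- `Summit.<Summit>.<Problem>`: for the single-conjunct summit `PneNP` the duplicate `PneNP.PneNP` is mandated.
set_option linter.dupNamespace false

namespace Summit.PneNP.PneNP.Theorems.PrimalityWidthHard.Negative

open Literature.Computability.Complexity Literature.Computability.MetaComplexity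

/-! ### The route's inline encoding, mirrored as definitions (definitionally equal) -/

section Encoding

variable (n : ℕ)

/-- variable index of `x_i`. [folklore] -/
def vX (i : ℕ) : ℕ := i
/-- variable index of `y_j`. [folklore] -/
def vY (j : ℕ) : ℕ := n + j
/-- variable index of the partial product `x_i ∧ y_j`. [folklore] -/
def vPP (i j : ℕ) : ℕ := 2 * n + i * n + j
/-- variable index of the sum bit of row `i`, column `k`. [folklore] -/
def vS (i k : ℕ) : ℕ := 2 * n + n * n + i * (2 * n) + k
/-- variable index of the carry INTO position `j` of row `i` (`vC i n` = carry out). [folklore] -/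
def vC (i j : ℕ) : ℕ := 2 * n + 3 * (n * n) + i * (n + 1) + j
/-- the constant-zero wire. [folklore] -/
def vZ0 : ℕ := 3 * n + 4 * (n * n)
/-- accumulator bit `k` after row `i`. [folklore] -/
def acc (i k : ℕ) : ℕ :=
  if i = 0 then (if k < n then vPP n 0 k else vZ0 n) else if k = 0 then vPP n 0 0 else
    if k < i then vS n k k else if k < n + i then vS n i k else vC n i n
/-- carry into cell `(i, j)`. [folklore] -/
def cin (i j : ℕ) : ℕ := if j = 0 then vZ0 n else vC n i j
/-- Tseitin clauses of `z ↔ a ∧ b`. [folklore] -/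
def andCl (z a b : ℕ) : CNF ℕ :=
  [[(z, false), (a, true)], [(z, false), (b, true)], [(z, true), (a, false), (b, false)]]
/-- Tseitin clauses of `s ↔ a ⊕ b ⊕ c`. [folklore] -/
def xorCl (s a b c : ℕ) : CNF ℕ :=
  [[(a, false), (b, true), (c, true), (s, true)], [(a, true), (b, false), (c, true), (s, true)],
    [(a, true), (b, true), (c, false), (s, true)], [(a, true), (b, true), (c, true), (s, false)],
    [(a, false), (b, false), (c, false), (s, true)], [(a, false), (b, false), (c, true), (s, false)],
    [(a, false), (b, true), (c, false), (s, false)], [(a, true), (b, false), (c, false), (s, false)]]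
/-- Tseitin clauses of `m ↔ MAJ(a, b, c)`. [folklore] -/
def majCl (m a b c : ℕ) : CNF ℕ :=
  [[(m, false), (a, true), (b, true)], [(m, false), (a, true), (c, true)],
    [(m, false), (b, true), (c, true)], [(m, true), (a, false), (b, false)],
    [(m, true), (a, false), (c, false)], [(m, true), (b, false), (c, false)]]
/-- the array multiplier. [folklore] -/
def mulCNF : CNF ℕ :=
  [[(vZ0 n, false)]] ++
    ((List.range n).flatMap fun i => (List.range n).flatMap fun j =>
      andCl (vPP n i j) (vX i) (vY n j)) ++
    ((List.range n).flatMap fun i => if i = 0 then [] else (List.range n).flatMap fun j =>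
      xorCl (vS n i (i + j)) (acc n (i - 1) (i + j)) (vPP n i j) (cin n i j) ++
        majCl (vC n i (j + 1)) (acc n (i - 1) (i + j)) (vPP n i j) (cin n i j))
/-- output bit `k`. [folklore] -/
def vZ (k : ℕ) : ℕ := acc n (n - 1) k
/-- the output units `Z_k = bit k of p`. [folklore] -/
def outCl (p : ℕ) : CNF ℕ := (List.range (2 * n)).map fun k => [(vZ n k, Nat.testBit p k)]
/-- `balancedCNF n p` of the route file. [folklore] -/
def balancedCNF (p : ℕ) : CNF ℕ :=
  mulCNF n ++ outCl n p ++ [[(vX (n - 1), true)], [(vY n (n - 1), true)]]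

end Encoding

/-- The crux, restated through the mirrored encoding (definitional unfolding only). [folklore] -/
theorem primalityWidthHard_iff :
    Summit.PneNP.PneNP.Theses.PrimalityPlaces.PrimalityWidthHard ↔
      ∃ ε : ℝ, 0 < ε ∧ ∃ N : ℕ, ∀ n ≥ N, ∀ p : ℕ, p.Prime → 4 ^ (n - 1) ≤ p → p < 4 ^ n →
        ∀ π : List (ResLine ℕ), IsResRefutation (balancedCNF n p) π →
          ε * (n : ℝ) ≤ (resWidth π : ℝ) :=
  Iff.rfl

/-! ### Width-4 derivability: the Atserias–Dalmau closure `NarrowDerivable φ 4` -/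

/-- Weakening inside the width bound preserves narrow derivability (append one `weaken` line).
[Krajíček 2019, §5.1 (R with weakening)] [folklore] -/
theorem narrowDerivable_weaken {φ : CNF ℕ} {w : ℕ} {C E : Finset (Literal ℕ)}
    (hC : NarrowDerivable φ w C) (hCE : C ⊆ E) (hE : E.card ≤ w) : NarrowDerivable φ w E := by
  intro π hπ hπw
  obtain ⟨τ, hτ, hτw, i, hi, hiC⟩ := hC π hπ hπw
  have hval : IsValidResLine φ (π ++ τ) ⟨E, .weaken i⟩ := by
    change ∃ hi : i < (π ++ τ).length, ((π ++ τ)[i]'hi).clause ⊆ E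
    exact ⟨hi, by rw [hiC]; exact hCE⟩
  refine ⟨τ ++ [⟨E, .weaken i⟩], ?_, ?_, (π ++ τ).length, ?_, ?_⟩
  · simpa only [List.append_assoc] using hτ.append_singleton hval
  · rw [resWidth_le_iff] at hτw ⊢
    intro l hl
    simp only [← List.append_assoc, List.mem_append, List.mem_singleton] at hl
    rcases hl with hl | rfl
    · exact hτw l (List.mem_append.2 hl)
    · exact hE
  · simp
  · simp only [← List.append_assoc]
    rw [List.getElem_append_right le_rfl]
    simp

/-- Axiom download with weakening, list form. [folklore] -/
theorem nd_ax {φ : CNF ℕ} {c : Clause ℕ} (E : Finset (Literal ℕ)) (hc : c ∈ φ)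
    (hsub : (∀ l ∈ c, l ∈ E) := by simp) (hE : E.card ≤ 4 := by
      first
        | exact Finset.card_le_four
        | exact Finset.card_le_three.trans (by norm_num)
        | exact Finset.card_le_two.trans (by norm_num)
        | (rw [Finset.card_singleton]; norm_num)
        | simp) :
    NarrowDerivable φ 4 E := by
  have hcE : c.toFinset ⊆ E := fun l hl => hsub l (List.mem_toFinset.1 hl)
  exact narrowDerivable_weaken
    (narrowDerivable_of_mem hc ((Finset.card_le_card hcE).trans hE)) hcE hE

/-- Resolution on `v` with weakening: no distinctness of variables is ever needed, only
syntactic membership. [folklore] -/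
theorem nd_res {φ : CNF ℕ} {C D : Finset (Literal ℕ)} (v : ℕ) (E : Finset (Literal ℕ))
    (hC : NarrowDerivable φ 4 C) (hD : NarrowDerivable φ 4 D)
    (hvC : (v, true) ∈ C := by simp) (hvD : (v, false) ∈ D := by simp)
    (hCE : (∀ l ∈ C, l = (v, true) ∨ l ∈ E) := by simp)
    (hDE : (∀ l ∈ D, l = (v, false) ∨ l ∈ E) := by simp)
    (hE : E.card ≤ 4 := by
      first
        | exact Finset.card_le_four
        | exact Finset.card_le_three.trans (by norm_num)
        | exact Finset.card_le_two.trans (by norm_num)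
        | (rw [Finset.card_singleton]; norm_num)
        | simp) : NarrowDerivable φ 4 E := by
  have hsub : C.erase (v, true) ∪ D.erase (v, false) ⊆ E := by
    intro l hl
    rcases Finset.mem_union.1 hl with hl | hl
    · obtain ⟨hne, hl⟩ := Finset.mem_erase.1 hl
      exact (hCE l hl).resolve_left hne
    · obtain ⟨hne, hl⟩ := Finset.mem_erase.1 hl
      exact (hDE l hl).resolve_left hne
  exact narrowDerivable_weaken (narrowDerivable_of_isResolvent ⟨hvC, hvD, rfl⟩ hC hD
    ((Finset.card_le_card hsub).trans hE)) hsub hE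

/-- A width-≤4 refutation from `NarrowDerivable φ 4 ∅`. [Atserias–Dalmau 2008, Lemma 2] [folklore] -/
theorem exists_refutation_of_nd_empty {φ : CNF ℕ} (h : NarrowDerivable φ 4 ∅) :
    ∃ π : List (ResLine ℕ), IsResRefutation φ π ∧ resWidth π ≤ 4 := by
  obtain ⟨τ, hτ, hτw, i, hi, hiC⟩ := h [] (isResDerivation_nil φ) (by simp [resWidth])
  simp only [List.nil_append] at hτ hτw hi hiC
  exact ⟨τ, ⟨hτ, τ[i], List.getElem_mem hi, hiC⟩, hτw⟩

/-! ### One full adder, backwards: sum 0 and carry-out 0 force the three inputs to 0 -/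

/-- Carry-out `0` gives the three pairwise NANDs of the inputs (width ≤ 3). [folklore] -/
theorem maj_nands {φ : CNF ℕ} {a b c m : ℕ} (hm : ∀ cl ∈ majCl m a b c, cl ∈ φ)
    (hmF : NarrowDerivable φ 4 {(m, false)}) :
    NarrowDerivable φ 4 {(a, false), (b, false)} ∧ NarrowDerivable φ 4 {(a, false), (c, false)} ∧
      NarrowDerivable φ 4 {(b, false), (c, false)} := by
  refine ⟨?_, ?_, ?_⟩
  · exact nd_res m _ (nd_ax {(m, true), (a, false), (b, false)}
      (hm [(m, true), (a, false), (b, false)] (by simp [majCl]))) hmF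
  · exact nd_res m _ (nd_ax {(m, true), (a, false), (c, false)}
      (hm [(m, true), (a, false), (c, false)] (by simp [majCl]))) hmF
  · exact nd_res m _ (nd_ax {(m, true), (b, false), (c, false)}
      (hm [(m, true), (b, false), (c, false)] (by simp [majCl]))) hmF

/-- Backward propagation through a full adder in width 4: sum `0` and carry-out `0` force all
three inputs to `0`. [folklore] -/
theorem cell_inputs_false {φ : CNF ℕ} {a b c s m : ℕ}
    (hx : ∀ cl ∈ xorCl s a b c, cl ∈ φ) (hm : ∀ cl ∈ majCl m a b c, cl ∈ φ)
    (hs : NarrowDerivable φ 4 {(s, false)}) (hmF : NarrowDerivable φ 4 {(m, false)}) :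
    NarrowDerivable φ 4 {(a, false)} ∧ NarrowDerivable φ 4 {(b, false)} ∧
      NarrowDerivable φ 4 {(c, false)} := by
  obtain ⟨NAB, NAC, NBC⟩ := maj_nands hm hmF
  refine ⟨?_, ?_, ?_⟩
  · -- `¬a ∨ b ∨ c ∨ s` minus `s`, minus `b` (NAB), minus `c` (NAC)
    have h1 : NarrowDerivable φ 4 {(a, false), (b, true), (c, true)} :=
      nd_res s _ (nd_ax {(a, false), (b, true), (c, true), (s, true)}
        (hx [(a, false), (b, true), (c, true), (s, true)] (by simp [xorCl]))) hs
    have h2 : NarrowDerivable φ 4 {(a, false), (c, true)} := nd_res b _ h1 NAB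
    exact nd_res c _ h2 NAC
  · have h1 : NarrowDerivable φ 4 {(a, true), (b, false), (c, true)} :=
      nd_res s _ (nd_ax {(a, true), (b, false), (c, true), (s, true)}
        (hx [(a, true), (b, false), (c, true), (s, true)] (by simp [xorCl]))) hs
    have h2 : NarrowDerivable φ 4 {(b, false), (c, true)} := nd_res a _ h1 NAB
    exact nd_res c _ h2 NBC
  · have h1 : NarrowDerivable φ 4 {(a, true), (b, true), (c, false)} :=
      nd_res s _ (nd_ax {(a, true), (b, true), (c, false), (s, true)}
        (hx [(a, true), (b, true), (c, false), (s, true)] (by simp [xorCl]))) hs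
    have h2 : NarrowDerivable φ 4 {(b, true), (c, false)} := nd_res a _ h1 NAC
    exact nd_res b _ h2 NBC

/-- The corner adder: carry-out `0` and partial product `1` force the other two inputs to `0`.
[folklore] -/
theorem corner_inputs_false {φ : CNF ℕ} {a b c m : ℕ} (hm : ∀ cl ∈ majCl m a b c, cl ∈ φ)
    (hbT : NarrowDerivable φ 4 {(b, true)}) (hmF : NarrowDerivable φ 4 {(m, false)}) :
    NarrowDerivable φ 4 {(a, false)} ∧ NarrowDerivable φ 4 {(c, false)} := by
  obtain ⟨NAB, -, NBC⟩ := maj_nands hm hmF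
  exact ⟨nd_res b _ hbT NAB, nd_res b _ hbT NBC⟩

/-! ### Clauses of `balancedCNF n p` -/

section Membership

variable {n p : ℕ}

/-- Multiplier clauses are clauses of `balancedCNF`. [folklore] -/
theorem mem_of_mem_mulCNF {cl : Clause ℕ} (h : cl ∈ mulCNF n) : cl ∈ balancedCNF n p := by
  simp only [balancedCNF, List.mem_append]
  exact Or.inl (Or.inl h)

/-- The and-gate clauses of cell `(i, j)`. [folklore] -/
theorem and_mem {i j : ℕ} (hi : i < n) (hj : j < n) {cl : Clause ℕ}
    (h : cl ∈ andCl (vPP n i j) (vX i) (vY n j)) : cl ∈ balancedCNF n p := by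
  refine mem_of_mem_mulCNF ?_
  simp only [mulCNF, List.mem_append, List.mem_flatMap, List.mem_range]
  exact Or.inl (Or.inr ⟨i, hi, j, hj, h⟩)

/-- The XOR clauses of the full adder `(i, j)`, `1 ≤ i`. [folklore] -/
theorem xor_mem {i j : ℕ} (hi0 : i ≠ 0) (hi : i < n) (hj : j < n) {cl : Clause ℕ}
    (h : cl ∈ xorCl (vS n i (i + j)) (acc n (i - 1) (i + j)) (vPP n i j) (cin n i j)) :
    cl ∈ balancedCNF n p := by
  refine mem_of_mem_mulCNF ?_
  simp only [mulCNF, List.mem_append, List.mem_flatMap, List.mem_range]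
  refine Or.inr ⟨i, hi, ?_⟩
  rw [if_neg hi0]
  simp only [List.mem_flatMap, List.mem_range, List.mem_append]
  exact ⟨j, hj, Or.inl h⟩

/-- The MAJ clauses of the full adder `(i, j)`, `1 ≤ i`. [folklore] -/
theorem maj_mem {i j : ℕ} (hi0 : i ≠ 0) (hi : i < n) (hj : j < n) {cl : Clause ℕ}
    (h : cl ∈ majCl (vC n i (j + 1)) (acc n (i - 1) (i + j)) (vPP n i j) (cin n i j)) :
    cl ∈ balancedCNF n p := by
  refine mem_of_mem_mulCNF ?_
  simp only [mulCNF, List.mem_append, List.mem_flatMap, List.mem_range]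
  refine Or.inr ⟨i, hi, ?_⟩
  rw [if_neg hi0]
  simp only [List.mem_flatMap, List.mem_range, List.mem_append]
  exact ⟨j, hj, Or.inr h⟩

/-- The output unit `Z_k = bit k of p`. [folklore] -/
theorem out_mem {k : ℕ} (hk : k < 2 * n) : [(vZ n k, Nat.testBit p k)] ∈ balancedCNF n p := by
  simp only [balancedCNF, outCl, List.mem_append, List.mem_map, List.mem_range]
  exact Or.inl (Or.inr ⟨k, hk, rfl⟩)

/-- The balance unit `x_{n-1} = 1`. [folklore] -/
theorem xtop_mem : [(vX (n - 1), true)] ∈ balancedCNF n p :=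
  List.mem_append.2 (Or.inr (by simp))

/-- The balance unit `y_{n-1} = 1`. [folklore] -/
theorem ytop_mem : [(vY n (n - 1), true)] ∈ balancedCNF n p :=
  List.mem_append.2 (Or.inr (by simp))

/-- A zero output bit as a derived negative unit. [folklore] -/
theorem outF {k : ℕ} (hk : k < 2 * n) (hb : Nat.testBit p k = false) :
    NarrowDerivable (balancedCNF n p) 4 {(vZ n k, false)} := by
  have h := out_mem (n := n) (p := p) hk
  rw [hb] at h
  exact nd_ax _ h

/-- A one output bit as a derived positive unit. [folklore] -/
theorem outT {k : ℕ} (hk : k < 2 * n) (hb : Nat.testBit p k = true) :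
    NarrowDerivable (balancedCNF n p) 4 {(vZ n k, true)} := by
  have h := out_mem (n := n) (p := p) hk
  rw [hb] at h
  exact nd_ax _ h

end Membership

/-! ### Index identities of the accumulator wiring -/

section Wiring

variable (n : ℕ)

/-- Inside row `i ≥ 1` the accumulator bit is the row's sum bit. [folklore] -/
theorem acc_S {i k : ℕ} (hi : i ≠ 0) (hik : i ≤ k) (hk : k < n + i) : acc n i k = vS n i k := by
  unfold acc
  rw [if_neg hi, if_neg (by omega), if_neg (by omega), if_pos hk]

/-- Past the row the accumulator bit is the row's carry-out. [folklore] -/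
theorem acc_C {i k : ℕ} (hi : i ≠ 0) (hk : n + i ≤ k) : acc n i k = vC n i n := by
  unfold acc
  rw [if_neg hi, if_neg (by omega), if_neg (by omega), if_neg (by omega)]

/-- Row `0` is the partial products `x_0 ∧ y_k`. [folklore] -/
theorem acc_zero {k : ℕ} (hk : k < n) : acc n 0 k = vPP n 0 k := by
  unfold acc
  rw [if_pos rfl, if_pos hk]

/-- The carry into position `j ≥ 1` is a carry variable. [folklore] -/
theorem cin_ne {i j : ℕ} (hj : j ≠ 0) : cin n i j = vC n i j := by
  unfold cin
  rw [if_neg hj]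

/-- Output bit `0` is `x_0 ∧ y_0` (for `n ≥ 2`). [folklore] -/
theorem vZ_zero (hn : 2 ≤ n) : vZ n 0 = vPP n 0 0 := by
  unfold vZ acc
  rw [if_neg (by omega), if_pos rfl]

end Wiring

end Summit.PneNP.PneNP.Theorems.PrimalityWidthHard.Negative
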